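import Literature.NumberTheory.EllipticCurves.SigmaODELogDerivProofs
import Literature.NumberTheory.EllipticCurves.FormalGroupXDerivativeProofs
import Literature.NumberTheory.EllipticCurves.MvPowerSeriesLogDerivWronskianProofs
import HarnessLib

/-!
# The pseudo-addition theorem for the quasi-period function `η₀` — I: the algebraic identity and the
# Wronskian lemma (proofs only)

Topic `Literature/NumberTheory/EllipticCurves`; first of two proof files behind the pseudo-addition
theorem for the quasi-period function `η₀ = formalQuasiPeriod` of a Weierstrass formal group
(`FormalGroupQuasiPeriod`, named fact `WeierstrassCurve.formalQuasiPeriod_addition`):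
`u·v·N·F·C₀ = u·v·N - (u + v)·N·F - M·F` for the addition cocycle `C₀ = η₀(u +_F v) - η₀(u) - η₀(v)`,
`N = X(u)v² - X(v)u²`, `M = X(v)u³ - X(u)v³` (Whittaker–Watson §20·41 on the formal group). This file
holds the two ingredients that do not mention `η₀`:

* §1 `quasiPeriod_wronskian_identity` — a polynomial identity in a commutative ring (the algebraic
  heart: modulo `Dx = 2y + a₁x + a₃`, `η·X = 3X² - 2X + ⋯`, the chord formula for `x(u +_F v)` and the
  two Weierstrass relations, `(uvNF)²·E = u²F²·((uvNF)·D₁N' - N'·D₁(uvNF))` with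
  `E = u²(X(F) - η(F)) - F²(X(u) - η(u))` (`= u²F²·D₁C₀`) and `N' = uvN - (u+v)NF - MF` — the
  pole-cleared form of `D₁λ = x₁ - x₃` on `E × E`; the cofactors were found by elimination);
* §2 the relations in `A⟦u, v⟧` (the tree's one-variable identities read in `u`, `v`) and the Leibniz
  expansions of `D₁(uvNF)`, `D₁N'` for the invariant derivation `D₁ = η(u)∂ᵤ`;
* §3 `eq_zero_of_pderiv_mul_eq_of_X_mul` — a Wronskian lemma with a simple zero: over a domain of
  characteristic `0`, `∂ᵤh·(uG) = h·∂ᵤ(uG)`, `G(0,v) ≠ 0`, `h(0,v) = 0 = (∂ᵤh)(0,v)` force `h = 0`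
  (extends the tree's `eq_zero_of_pderiv_mul_eq`, Blakestad–Grant's "constant of integration" step).

The sequel `FormalGroupQuasiPeriodAdditionProofs` concludes. BSD context: crux K★
`stmt-BirchSwinnertonDyer-22226`, hDR sector (iii) (`η`-period of the Weierstrass formal group); BSD is not
proved by any of this.

## References
* J. H. Silverman, *The Arithmetic of Elliptic Curves* (2009), III.2.3, IV.1. [SilvermanAEC2009]
* C. Blakestad, D. Grant, J. Number Theory 249 (2023), §3, Prop. 14 (the `D₁` method). [BlakestadGrant2023]
* E. T. Whittaker, G. N. Watson, *A Course of Modern Analysis* (1927), §20·41. [WhittakerWatson1927]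
-/

noncomputable section

open PowerSeries Literature.NumberTheory.EllipticCurves
open Literature.AlgebraicGeometry.Resolution (MvPowerSeries.pderiv MvPowerSeries.pderiv_X
  MvPowerSeries.pderiv_powerSeries_subst MvPowerSeries.pderiv_powerSeries_subst_X)

namespace WeierstrassCurve

/-! ### §1 The generic polynomial identity -/

/-- **The algebraic heart of the pseudo-addition theorem** (pure commutative algebra): for elements
`u, v, Xu = X(u), Xv = X(v), F, XF = X(F), ηu = η(u), ηF = η(F), DXu = (DX)(u)` of a commutative ring
subject to `u·DXu = 2ηuXu + Ỹ(u)` (`Dx = 2y + a₁x + a₃`), `ηu·Xu = 3Xu² - 2Xu + ⋯` (`η = dz/ω`), the chord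
formula for `XF` and the Weierstrass relations at `u` and `v`, and for `DM`, `DN` the values of the
derivation `D₁` (`D₁u = ηu`, `D₁v = 0`, `D₁Xu = DXu`, `D₁Xv = 0`, `D₁F = ηF`) on `M' = uvNF` and
`N' = uvN - (u+v)NF - MF`: `N²u²v²·Xu·u · (M'²·E - u²F²(M'·DN - N'·DM)) = 0` with
`E = u²(XF - ηF) - F²(Xu - ηu)` (`= u²F²·D₁C₀`). The cofactors were found by successive elimination
(`DXu`, `ηu`, `XF`, then reduction by the two cubic relations). [Silverman AEC III.2.3 (`D₁λ = x₁ - x₃`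
unwound)] [cite: SilvermanAEC2009, III.2.3] -/
theorem quasiPeriod_wronskian_identity {S : Type*} [CommRing S]
    (a₁ a₂ a₃ a₄ a₆ u v Xu Xv F XF ηu ηF DXu DM DN : S)
    (hK3 : u * DXu = 2 * ηu * Xu + ((a₁ * u - 2) * Xu + a₃ * u ^ 3))
    (hK2 : ηu * Xu = 3 * Xu ^ 2 - 2 * Xu + 2 * a₁ * u * Xu + 2 * a₂ * u ^ 2 * Xu + a₃ * u ^ 3 +
      a₄ * u ^ 4)
    (hK4 : XF * (Xu * v ^ 2 - Xv * u ^ 2) ^ 2 * u ^ 2 * v ^ 2 =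
      F ^ 2 * ((Xv * u ^ 3 - Xu * v ^ 3) ^ 2 + a₁ * (Xv * u ^ 3 - Xu * v ^ 3) * (Xu * v ^ 2 - Xv * u ^ 2) * u * v -
        (a₂ * u ^ 2 * v ^ 2 + Xu * v ^ 2 + Xv * u ^ 2) * (Xu * v ^ 2 - Xv * u ^ 2) ^ 2))
    (hK1u : Xu ^ 2 = Xu ^ 3 + a₁ * u * Xu ^ 2 + a₂ * u ^ 2 * Xu ^ 2 + a₃ * u ^ 3 * Xu + a₄ * u ^ 4 * Xu +
      a₆ * u ^ 6)
    (hK1v : Xv ^ 2 = Xv ^ 3 + a₁ * v * Xv ^ 2 + a₂ * v ^ 2 * Xv ^ 2 + a₃ * v ^ 3 * Xv + a₄ * v ^ 4 * Xv +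
      a₆ * v ^ 6)
    (hDM : DM = v ^ 3 * Xu * F * ηu + u * v ^ 3 * F * DXu + u * v ^ 3 * Xu * ηF + (-3) * u ^ 2 * v * Xv * F * ηu + -(u ^ 3 * v * Xv * ηF))
    (hDN : DN = -(v ^ 2 * Xu * F * ηu) + v ^ 3 * Xu * ηu + (2) * u * v * Xv * F * ηu + -(u * v ^ 2 * F * DXu) + -(u * v ^ 2 * Xu * ηF) + u * v ^ 3 * DXu + u ^ 2 * v * Xv * ηF + (-3) * u ^ 2 * v * Xv * ηu) :
    (Xu * v ^ 2 - Xv * u ^ 2) ^ 2 * u ^ 2 * v ^ 2 * Xu * u *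
      ((u * v * (Xu * v ^ 2 - Xv * u ^ 2) * F) ^ 2 * (u ^ 2 * (XF - ηF) - F ^ 2 * (Xu - ηu)) -
        u ^ 2 * F ^ 2 *
          ((u * v * (Xu * v ^ 2 - Xv * u ^ 2) * F) * DN -
            (u * v * (Xu * v ^ 2 - Xv * u ^ 2) - (u + v) * (Xu * v ^ 2 - Xv * u ^ 2) * F -
              (Xv * u ^ 3 - Xu * v ^ 3) * F) * DM)) = 0 := by
  subst hDM hDN
  linear_combination (u ^ 7 * v ^ 10 * Xu ^ 3 * Xv * F ^ 4 + -(u ^ 8 * v ^ 9 * Xu ^ 3 * Xv * F ^ 4) + (-2) * u ^ 9 * v ^ 8 * Xu ^ 2 * Xv ^ 2 * F ^ 4 + (2) * u ^ 10 * v ^ 7 * Xu ^ 2 * Xv ^ 2 * F ^ 4 + u ^ 11 * v ^ 6 * Xu * Xv ^ 3 * F ^ 4 + -(u ^ 12 * v ^ 5 * Xu * Xv ^ 3 * F ^ 4)) * hK3 + (u ^ 5 * v ^ 12 * Xu ^ 4 * F ^ 4 + (-3) * u ^ 7 * v ^ 10 * Xu ^ 3 * Xv * F ^ 4 + (3) *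 u ^ 9 * v ^ 8 * Xu ^ 2 * Xv ^ 2 * F ^ 4 + -(u ^ 11 * v ^ 6 * Xu * Xv ^ 3 * F ^ 4)) * hK2 + (u ^ 5 * v ^ 6 * Xu ^ 3 * F ^ 2 + (-2) * u ^ 7 * v ^ 4 * Xu ^ 2 * Xv * F ^ 2 + u ^ 9 * v ^ 2 * Xu * Xv ^ 2 * F ^ 2) * hK4 +
    (-(u ^ 5 * v ^ 12 * Xu ^ 3 * F ^ 4) + (2) * u ^ 7 * v ^ 10 * Xu ^ 2 * Xv * F ^ 4 + -(u ^ 9 * v ^ 8 * Xu * Xv ^ 2 * F ^ 4) + -(u ^ 11 * v ^ 6 * Xv ^ 2 * F ^ 4) + u ^ 11 * v ^ 6 * Xv ^ 3 * F ^ 4 + a₆ * u ^ 11 * v ^ 12 * F ^ 4 + a₄ * u ^ 11 * v ^ 10 * Xv * F ^ 4 + a₃ * u ^ 11 * v ^ 9 * Xv * F ^ 4 + a₂ * u ^ 11 * v ^ 8 * Xv ^ 2 * F ^ 4 + a₁ * u ^ 11 * v ^ 7 * Xv ^ 2 * F ^ 4) * hK1u + (u ^ 11 * v ^ 6 * Xu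 ^ 2 * F ^ 4 + (-2) * u ^ 13 * v ^ 4 * Xu ^ 2 * Xv * F ^ 4 + u ^ 15 * v ^ 2 * Xu * Xv ^ 2 * F ^ 4 + -(a₆ * u ^ 17 * v ^ 6 * F ^ 4) + -(a₄ * u ^ 15 * v ^ 6 * Xu * F ^ 4) + -(a₃ * u ^ 14 * v ^ 6 * Xu * F ^ 4) + -(a₂ * u ^ 13 * v ^ 6 * Xu ^ 2 * F ^ 4) + -(a₁ * u ^ 12 * v ^ 6 * Xu ^ 2 * F ^ 4)) * hK1v

/-! ### §2 The relations in `A⟦u, v⟧` and the Wronskian relation for `Ψ` -/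

section Relations

variable {A : Type*} [CommRing A] (V : WeierstrassCurve A)

/-- `u·(DX)(u) = 2η(u)X(u) + ((a₁u - 2)X(u) + a₃u³)` in `A⟦u, v⟧` (the tree's `Dx = 2y + a₁x + a₃`,
`X_mul_formalInvariantDerivation_formalXMulSq`, read in the variable `u`). [cite: SilvermanAEC2009, IV.1.1] -/
theorem subst_X_zero_X_mul_formalInvariantDerivation_formalXMulSq :
    (MvPowerSeries.X 0 : MvPowerSeries (Fin 2) A) *
        (V.formalInvariantDerivation V.formalXMulSq).subst (MvPowerSeries.X 0 : MvPowerSeries (Fin 2) A) =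
      2 * V.formalEta.subst (MvPowerSeries.X 0 : MvPowerSeries (Fin 2) A) *
          V.formalXMulSq.subst (MvPowerSeries.X 0 : MvPowerSeries (Fin 2) A) +
        ((MvPowerSeries.C V.a₁ * MvPowerSeries.X 0 - 2) *
            V.formalXMulSq.subst (MvPowerSeries.X 0 : MvPowerSeries (Fin 2) A) +
          MvPowerSeries.C V.a₃ * (MvPowerSeries.X 0) ^ 3) := by
  have hs := PowerSeries.HasSubst.X (S := A) (0 : Fin 2)
  have h := congrArg (PowerSeries.substAlgHom hs) V.X_mul_formalInvariantDerivation_formalXMulSq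
  simp only [map_mul, map_add, map_sub, map_pow, map_ofNat, PowerSeries.coe_substAlgHom,
    PowerSeries.subst_X hs, PowerSeries.subst_C] at h
  exact h

/-- `η(u)·X(u) = 3X(u)² - 2X(u) + 2a₁uX(u) + 2a₂u²X(u) + a₃u³ + a₄u⁴` in `A⟦u, v⟧`
(`formalEta_mul_formalXMulSq` read in `u`). [cite: SilvermanAEC2009, IV.1.1] -/
theorem subst_X_zero_formalEta_mul_formalXMulSq :
    V.formalEta.subst (MvPowerSeries.X 0 : MvPowerSeries (Fin 2) A) *
        V.formalXMulSq.subst (MvPowerSeries.X 0 : MvPowerSeries (Fin 2) A) =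
      3 * V.formalXMulSq.subst (MvPowerSeries.X 0 : MvPowerSeries (Fin 2) A) ^ 2 -
        2 * V.formalXMulSq.subst (MvPowerSeries.X 0 : MvPowerSeries (Fin 2) A) +
        2 * MvPowerSeries.C V.a₁ * MvPowerSeries.X 0 *
          V.formalXMulSq.subst (MvPowerSeries.X 0 : MvPowerSeries (Fin 2) A) +
        2 * MvPowerSeries.C V.a₂ * (MvPowerSeries.X 0) ^ 2 *
          V.formalXMulSq.subst (MvPowerSeries.X 0 : MvPowerSeries (Fin 2) A) +
        MvPowerSeries.C V.a₃ * (MvPowerSeries.X 0) ^ 3 + MvPowerSeries.C V.a₄ * (MvPowerSeries.X 0) ^ 4 := by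
  have hs := PowerSeries.HasSubst.X (S := A) (0 : Fin 2)
  have h := congrArg (PowerSeries.substAlgHom hs) V.formalEta_mul_formalXMulSq
  simp only [map_mul, map_add, map_sub, map_pow, map_ofNat, PowerSeries.coe_substAlgHom,
    PowerSeries.subst_X hs, PowerSeries.subst_C] at h
  exact h

/-- The Weierstrass relation `X² = X³ + a₁zX² + a₂z²X² + a₃z³X + a₄z⁴X + a₆z⁶` read in the variable
`zᵢ` of `A⟦u, v⟧` (`formalXMulSq_sq_eq`). [cite: SilvermanAEC2009, IV.1.1] -/
theorem subst_X_formalXMulSq_sq_eq (i : Fin 2) :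
    V.formalXMulSq.subst (MvPowerSeries.X i : MvPowerSeries (Fin 2) A) ^ 2 =
      V.formalXMulSq.subst (MvPowerSeries.X i : MvPowerSeries (Fin 2) A) ^ 3 +
        MvPowerSeries.C V.a₁ * MvPowerSeries.X i *
          V.formalXMulSq.subst (MvPowerSeries.X i : MvPowerSeries (Fin 2) A) ^ 2 +
        MvPowerSeries.C V.a₂ * (MvPowerSeries.X i) ^ 2 *
          V.formalXMulSq.subst (MvPowerSeries.X i : MvPowerSeries (Fin 2) A) ^ 2 +
        MvPowerSeries.C V.a₃ * (MvPowerSeries.X i) ^ 3 *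
          V.formalXMulSq.subst (MvPowerSeries.X i : MvPowerSeries (Fin 2) A) +
        MvPowerSeries.C V.a₄ * (MvPowerSeries.X i) ^ 4 *
          V.formalXMulSq.subst (MvPowerSeries.X i : MvPowerSeries (Fin 2) A) +
        MvPowerSeries.C V.a₆ * (MvPowerSeries.X i) ^ 6 := by
  have hs := PowerSeries.HasSubst.X (S := A) i
  have h := congrArg (PowerSeries.substAlgHom hs) V.formalXMulSq_sq_eq
  simp only [map_mul, map_add, map_pow, PowerSeries.coe_substAlgHom, PowerSeries.subst_X hs,
    PowerSeries.subst_C] at h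
  exact h

variable [IsDomain A]

/-- `D₁F = η(F)`: the invariance of the differential. [Blakestad–Grant 2023, §3] [cite: BlakestadGrant2023, §3] -/
theorem formalInvariantDerivationMv_formalGroupLaw :
    V.formalInvariantDerivationMv 0 V.formalGroupLaw = V.formalEta.subst V.formalGroupLaw := by
  rw [formalInvariantDerivationMv_apply, V.formalEta_subst_X_mul_pderiv_formalGroupLaw 0]

/-- `D₁(uvNF) = v³XuFηu + uv³F·DXu + uv³Xu·ηF - 3u²vXvFηu - u³vXv·ηF` (Leibniz). [cite: BlakestadGrant2023, §3] -/
theorem formalInvariantDerivationMv_M' :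
    V.formalInvariantDerivationMv 0
        ((MvPowerSeries.X 0 : MvPowerSeries (Fin 2) A) * MvPowerSeries.X 1 *
          (V.formalXMulSq.subst (MvPowerSeries.X 0 : MvPowerSeries (Fin 2) A) * MvPowerSeries.X 1 ^ 2 -
            V.formalXMulSq.subst (MvPowerSeries.X 1 : MvPowerSeries (Fin 2) A) * MvPowerSeries.X 0 ^ 2) *
          V.formalGroupLaw) =
      (MvPowerSeries.X 1 : MvPowerSeries (Fin 2) A) ^ 3 * V.formalXMulSq.subst (MvPowerSeries.X 0 : MvPowerSeries (Fin 2) A) * V.formalGroupLaw * V.formalEta.subst (MvPowerSeries.X 0 : MvPowerSeries (Fin 2) A) + (MvPowerSeries.X 0 : MvPowerSeries (Fin 2) A) * (MvPowerSeries.X 1 : MvPowerSeries (Fin 2) A) ^ 3 * V.formalGroupLaw * (V.formalInvariantDerivation V.formalXMulSq).subst (MvPowerSeries.X 0 : MvPowerSeries (Fin 2) A) + (MvPowerSeries.X 0 : MvPowerSeries (Fin 2) A) * (MvPowerSeries.X 1 : MvPowerSeries (Fin 2) A) ^ 3 * V.formalXMulSq.subst (MvPowerSeries.X 0 : MvPowerSeries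 (Fin 2) A) * V.formalEta.subst V.formalGroupLaw + (-3) * (MvPowerSeries.X 0 : MvPowerSeries (Fin 2) A) ^ 2 * (MvPowerSeries.X 1 : MvPowerSeries (Fin 2) A) * V.formalXMulSq.subst (MvPowerSeries.X 1 : MvPowerSeries (Fin 2) A) * V.formalGroupLaw * V.formalEta.subst (MvPowerSeries.X 0 : MvPowerSeries (Fin 2) A) + -((MvPowerSeries.X 0 : MvPowerSeries (Fin 2) A) ^ 3 * (MvPowerSeries.X 1 : MvPowerSeries (Fin 2) A) * V.formalXMulSq.subst (MvPowerSeries.X 1 : MvPowerSeries (Fin 2) A) * V.formalEta.subst V.formalGroupLaw) := by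
  simp only [Derivation.leibniz, Derivation.leibniz_pow, map_sub, smul_eq_mul,
    V.formalInvariantDerivationMv_X_self, V.formalInvariantDerivationMv_X_of_ne (show (1 : Fin 2) ≠ 0 by decide),
    V.formalInvariantDerivationMv_subst_X_zero, V.formalInvariantDerivationMv_subst_X_one,
    V.formalInvariantDerivationMv_formalGroupLaw, nsmul_eq_mul]
  ring

/-- `D₁(uvN - (u+v)NF - MF)` expanded (Leibniz). [cite: BlakestadGrant2023, §3] -/
theorem formalInvariantDerivationMv_N' :
    V.formalInvariantDerivationMv 0
        ((MvPowerSeries.X 0 : MvPowerSeries (Fin 2) A) * MvPowerSeries.X 1 *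
            (V.formalXMulSq.subst (MvPowerSeries.X 0 : MvPowerSeries (Fin 2) A) * MvPowerSeries.X 1 ^ 2 -
              V.formalXMulSq.subst (MvPowerSeries.X 1 : MvPowerSeries (Fin 2) A) * MvPowerSeries.X 0 ^ 2) -
          (MvPowerSeries.X 0 + MvPowerSeries.X 1) *
            (V.formalXMulSq.subst (MvPowerSeries.X 0 : MvPowerSeries (Fin 2) A) * MvPowerSeries.X 1 ^ 2 -
              V.formalXMulSq.subst (MvPowerSeries.X 1 : MvPowerSeries (Fin 2) A) * MvPowerSeries.X 0 ^ 2) *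
            V.formalGroupLaw -
          (V.formalXMulSq.subst (MvPowerSeries.X 1 : MvPowerSeries (Fin 2) A) * MvPowerSeries.X 0 ^ 3 -
              V.formalXMulSq.subst (MvPowerSeries.X 0 : MvPowerSeries (Fin 2) A) * MvPowerSeries.X 1 ^ 3) *
            V.formalGroupLaw) =
      -((MvPowerSeries.X 1 : MvPowerSeries (Fin 2) A) ^ 2 * V.formalXMulSq.subst (MvPowerSeries.X 0 : MvPowerSeries (Fin 2) A) * V.formalGroupLaw * V.formalEta.subst (MvPowerSeries.X 0 : MvPowerSeries (Fin 2) A)) + (MvPowerSeries.X 1 : MvPowerSeries (Fin 2) A) ^ 3 * V.formalXMulSq.subst (MvPowerSeries.X 0 : MvPowerSeries (Fin 2) A) * V.formalEta.subst (MvPowerSeries.X 0 : MvPowerSeries (Fin 2) A) + (2) * (MvPowerSeries.X 0 : MvPowerSeries (Fin 2) A) * (MvPowerSeries.X 1 : MvPowerSeries (Fin 2) A) * V.formalXMulSq.subst (MvPowerSeries.X 1 : MvPowerSeries (Fin 2) A) * V.formalGroupLaw * V.formalEta.subst (MvPowerSeries.X 0 : MvPowerSeries (Fin 2) A) + -((MvPowerSeries.X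 0 : MvPowerSeries (Fin 2) A) * (MvPowerSeries.X 1 : MvPowerSeries (Fin 2) A) ^ 2 * V.formalGroupLaw * (V.formalInvariantDerivation V.formalXMulSq).subst (MvPowerSeries.X 0 : MvPowerSeries (Fin 2) A)) + -((MvPowerSeries.X 0 : MvPowerSeries (Fin 2) A) * (MvPowerSeries.X 1 : MvPowerSeries (Fin 2) A) ^ 2 * V.formalXMulSq.subst (MvPowerSeries.X 0 : MvPowerSeries (Fin 2) A) * V.formalEta.subst V.formalGroupLaw) + (MvPowerSeries.X 0 : MvPowerSeries (Fin 2) A) * (MvPowerSeries.X 1 : MvPowerSeries (Fin 2) A) ^ 3 * (V.formalInvariantDerivation V.formalXMulSq).subst (MvPowerSeries.X 0 : MvPowerSeries (Fin 2) A) + (MvPowerSeries.X 0 : MvPowerSeries (Fin 2) A) ^ 2 * (MvPowerSeries.X 1 : MvPowerSeries (Fin 2) A) * V.formalXMulSq.subst (MvPowerSeries.X 1 : MvPowerSeries (Fin 2) A) * V.formalEta.subst V.formalGroupLaw + (-3) * (MvPowerSeries.X 0 : MvPowerSeries (Fin 2) A) ^ 2 * (MvPowerSeries.X 1 : MvPowerSeries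 (Fin 2) A) * V.formalXMulSq.subst (MvPowerSeries.X 1 : MvPowerSeries (Fin 2) A) * V.formalEta.subst (MvPowerSeries.X 0 : MvPowerSeries (Fin 2) A) := by
  simp only [Derivation.leibniz, Derivation.leibniz_pow, map_sub, map_add, smul_eq_mul,
    V.formalInvariantDerivationMv_X_self, V.formalInvariantDerivationMv_X_of_ne (show (1 : Fin 2) ≠ 0 by decide),
    V.formalInvariantDerivationMv_subst_X_zero, V.formalInvariantDerivationMv_subst_X_one,
    V.formalInvariantDerivationMv_formalGroupLaw, nsmul_eq_mul]
  ring

end Relations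


/-! ### §3 A Wronskian lemma with a simple zero, and `u ↦ 0` expansions -/

section Wronskian

variable {R : Type*} [CommRing R]

/-- `X₀ ≠ 0` in `R⟦u, v⟧`. [folklore] -/
private theorem aux_mvX_zero_ne_zero [Nontrivial R] : (MvPowerSeries.X 0 : MvPowerSeries (Fin 2) R) ≠ 0 := by
  intro h
  have := congrArg (MvPowerSeries.coeff (Finsupp.single (0 : Fin 2) 1)) h
  rw [MvPowerSeries.coeff_X, if_pos rfl, map_zero] at this
  exact one_ne_zero this

/-- A series whose restriction to `u = 0` is nonzero is nonzero. [folklore] -/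
private theorem aux_ne_zero_of_subst_zero_X {g : MvPowerSeries (Fin 2) R}
    (hg : MvPowerSeries.subst ![(0 : R⟦X⟧), PowerSeries.X] g ≠ 0) : g ≠ 0 := by
  rintro rfl
  exact hg (by rw [← MvPowerSeries.coe_substAlgHom hasSubst_zero_X, map_zero])

/-- `h(0, v) = 0` makes `h` divisible by `u`. [cite: BlakestadGrant2023, Prop. 14] -/
theorem X_zero_dvd_of_subst_zero_X_eq_zero {h : MvPowerSeries (Fin 2) R}
    (hh : MvPowerSeries.subst ![(0 : R⟦X⟧), PowerSeries.X] h = 0) :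
    (MvPowerSeries.X 0 : MvPowerSeries (Fin 2) R) ∣ h := by
  rw [MvPowerSeries.X_dvd_iff]
  intro m hm
  have hm1 : m = Finsupp.single 1 (m 1) := by
    ext i
    fin_cases i
    · simpa using hm
    · simp
  rw [hm1, ← coeff_subst_zero_X, hh, map_zero]

/-- **Wronskian lemma with a simple zero**: over an integral domain of characteristic zero, if
`∂ᵤh·(uG) = h·∂ᵤ(uG)` with `G(0, v) ≠ 0`, and `h(0, v) = 0`, `(∂ᵤh)(0, v) = 0`, then `h = 0` (the "constant
of integration" `h/(uG)`, a function of `v`, is read off at order `u¹`). [Blakestad–Grant 2023, proof of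
Prop. 14] [cite: BlakestadGrant2023, Prop. 14] -/
theorem eq_zero_of_pderiv_mul_eq_of_X_mul [IsDomain R] [CharZero R] {h G : MvPowerSeries (Fin 2) R}
    (hw : MvPowerSeries.pderiv 0 h * (MvPowerSeries.X 0 * G) = h * MvPowerSeries.pderiv 0 (MvPowerSeries.X 0 * G))
    (hG : MvPowerSeries.subst ![(0 : R⟦X⟧), PowerSeries.X] G ≠ 0)
    (hh0 : MvPowerSeries.subst ![(0 : R⟦X⟧), PowerSeries.X] h = 0)
    (hh1 : MvPowerSeries.subst ![(0 : R⟦X⟧), PowerSeries.X] (MvPowerSeries.pderiv 0 h) = 0) : h = 0 := by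
  obtain ⟨h', rfl⟩ := X_zero_dvd_of_subst_zero_X_eq_zero hh0
  have hd : MvPowerSeries.pderiv 0 ((MvPowerSeries.X 0 : MvPowerSeries (Fin 2) R) * h') =
      h' + MvPowerSeries.X 0 * MvPowerSeries.pderiv 0 h' := by
    rw [Derivation.leibniz, MvPowerSeries.pderiv_X, if_pos rfl, smul_eq_mul, smul_eq_mul, mul_one, add_comm]
  have hdG : MvPowerSeries.pderiv 0 ((MvPowerSeries.X 0 : MvPowerSeries (Fin 2) R) * G) =
      G + MvPowerSeries.X 0 * MvPowerSeries.pderiv 0 G := by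
    rw [Derivation.leibniz, MvPowerSeries.pderiv_X, if_pos rfl, smul_eq_mul, smul_eq_mul, mul_one, add_comm]
  rw [hd, hdG] at hw
  -- `u²·(∂h'·G - h'·∂G) = 0`
  have hw' : (MvPowerSeries.X 0 : MvPowerSeries (Fin 2) R) ^ 2 *
      (MvPowerSeries.pderiv 0 h' * G - h' * MvPowerSeries.pderiv 0 G) = 0 := by
    linear_combination hw
  have hu2 : (MvPowerSeries.X 0 : MvPowerSeries (Fin 2) R) ^ 2 ≠ 0 := pow_ne_zero 2 aux_mvX_zero_ne_zero
  have hw'' : MvPowerSeries.pderiv 0 h' * G = h' * MvPowerSeries.pderiv 0 G :=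
    sub_eq_zero.mp ((mul_eq_zero.mp hw').resolve_left hu2)
  -- `h'(0, v) = (∂ᵤh)(0, v) = 0`
  have hs := hasSubst_zero_X (R := R)
  have hh' : MvPowerSeries.subst ![(0 : R⟦X⟧), PowerSeries.X] h' = 0 := by
    rw [hd, MvPowerSeries.subst_add hs, MvPowerSeries.subst_mul hs, subst_zero_X_X_zero, zero_mul,
      add_zero] at hh1
    exact hh1
  rw [eq_zero_of_pderiv_mul_eq hw'' hh' hG, mul_zero]

end Wronskian

end WeierstrassCurve
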